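import Summits.Ventures.PercRepro.RankLevelSetLevelSevenArithPartThreeA
import Summits.Ventures.PercRepro.RankLevelSetLevelSevenArithPartThreeB
import Summits.Ventures.PercRepro.RankLevelSetLevelSevenArithPartThreeC
import Summits.Ventures.PercRepro.RankLevelSetLevelSevenArithPartThreeD
import Summits.Ventures.PercRepro.RankLevelSetLevelSevenArithPartThreeE
import Summits.Ventures.PercRepro.RankLevelSetLevelSevenArithPartThreeF
import Summits.Ventures.PercRepro.RankLevelSetLevelSevenArithPartThreeG
import Summits.Ventures.PercRepro.RankLevelSetLevelSevenArithPartThreeH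

/-!
# PercRepro — THE LEVEL-`7` DISPATCHER OF THE PARTITION CHAIN WITH THE THREE-MULTIPLICITY: `(P_d)` for `8 ≤ d ≤ 95`, `p ≥ 147`
(p4, gen 15; a feeder for S4). The 88 cases of RankLevelSetLevelSevenArithPartThreeA … H in one statement generic in `d`.
Axioms: standard.
-/

namespace PercRepro

namespace ThmN

/-- **`(P_d)` at level `7` in the `7/8` form with the three-multiplicity (partition count), every corank `8 ≤ d ≤ 95`,
every `p ≥ 147`, in `ℚ`** — the dispatcher of the 88 cases. -/
theorem level_seven_poly_part3 (d : ℕ) (hd1 : 8 ≤ d) (hd2 : d ≤ 95) (p : ℕ) (hp : 147 ≤ p) :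
    8 * ((((p + d).choose 7 : ℕ) : ℚ) + (∑ j ∈ Finset.range (d - 7), ((Nat.choose (min 71 (max ((d + min 33 d) / 2 + 1) (min 32 (d - 1) + 2) - 2)) j : ℕ) : ℚ) / (((j + 1) + 3 * (j + 1).choose 2 : ℕ) : ℚ)) *
      (((d * (d + 1) / 2 : ℕ) : ℚ) * ((p + d).choose 5 : ℚ) + ((d * (d + 1) * (d + 2) / 3 : ℕ) : ℚ) * ((p + d).choose 4 : ℚ) + (((d + 4).choose 5 : ℕ) : ℚ) * ((p + d).choose 3 : ℚ) + (((d + 5).choose 6 : ℕ) : ℚ) * ((p + d).choose 2 : ℚ) + (((d + 6).choose 7 : ℕ) : ℚ) * (p + d : ℚ) + (((d + 7).choose 8 : ℕ) : ℚ)) +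
      ((∑ j ∈ Finset.range (d - 7), ((Nat.choose (min 79 (7 + d) - 8) j : ℕ) : ℚ) / (((j + 1) + 3 * (j + 1).choose 2 : ℕ) : ℚ)) - (∑ j ∈ Finset.range (d - 7), ((Nat.choose (min 32 (d - 1)) j : ℕ) : ℚ) / (((j + 1) + 3 * (j + 1).choose 2 : ℕ) : ℚ))) *
      ((d * (d + 1) / 2 * (min 79 (7 + d)).choose 5 + d * (d + 1) * (d + 2) / 3 * (min 79 (7 + d)).choose 4 + (d + 4).choose 5 * (min 79 (7 + d)).choose 3 + (d + 5).choose 6 * (min 79 (7 + d)).choose 2 + (d + 6).choose 7 * (min 79 (7 + d)) + (d + 7).choose 8 : ℕ) : ℚ)) ≤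
      7 * 2 ^ (d - 7) * (((p + 7).choose 7 : ℕ) : ℚ) := by
  interval_cases d
  · exact level_seven_poly_part3_8 p hp
  · exact level_seven_poly_part3_9 p hp
  · exact level_seven_poly_part3_10 p hp
  · exact level_seven_poly_part3_11 p hp
  · exact level_seven_poly_part3_12 p hp
  · exact level_seven_poly_part3_13 p hp
  · exact level_seven_poly_part3_14 p hp
  · exact level_seven_poly_part3_15 p hp
  · exact level_seven_poly_part3_16 p hp
  · exact level_seven_poly_part3_17 p hp
  · exact level_seven_poly_part3_18 p hp
  · exact level_seven_poly_part3_19 p hp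
  · exact level_seven_poly_part3_20 p hp
  · exact level_seven_poly_part3_21 p hp
  · exact level_seven_poly_part3_22 p hp
  · exact level_seven_poly_part3_23 p hp
  · exact level_seven_poly_part3_24 p hp
  · exact level_seven_poly_part3_25 p hp
  · exact level_seven_poly_part3_26 p hp
  · exact level_seven_poly_part3_27 p hp
  · exact level_seven_poly_part3_28 p hp
  · exact level_seven_poly_part3_29 p hp
  · exact level_seven_poly_part3_30 p hp
  · exact level_seven_poly_part3_31 p hp
  · exact level_seven_poly_part3_32 p hp
  · exact level_seven_poly_part3_33 p hp
  · exact level_seven_poly_part3_34 p hp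
  · exact level_seven_poly_part3_35 p hp
  · exact level_seven_poly_part3_36 p hp
  · exact level_seven_poly_part3_37 p hp
  · exact level_seven_poly_part3_38 p hp
  · exact level_seven_poly_part3_39 p hp
  · exact level_seven_poly_part3_40 p hp
  · exact level_seven_poly_part3_41 p hp
  · exact level_seven_poly_part3_42 p hp
  · exact level_seven_poly_part3_43 p hp
  · exact level_seven_poly_part3_44 p hp
  · exact level_seven_poly_part3_45 p hp
  · exact level_seven_poly_part3_46 p hp
  · exact level_seven_poly_part3_47 p hp
  · exact level_seven_poly_part3_48 p hp
  · exact level_seven_poly_part3_49 p hp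
  · exact level_seven_poly_part3_50 p hp
  · exact level_seven_poly_part3_51 p hp
  · exact level_seven_poly_part3_52 p hp
  · exact level_seven_poly_part3_53 p hp
  · exact level_seven_poly_part3_54 p hp
  · exact level_seven_poly_part3_55 p hp
  · exact level_seven_poly_part3_56 p hp
  · exact level_seven_poly_part3_57 p hp
  · exact level_seven_poly_part3_58 p hp
  · exact level_seven_poly_part3_59 p hp
  · exact level_seven_poly_part3_60 p hp
  · exact level_seven_poly_part3_61 p hp
  · exact level_seven_poly_part3_62 p hp
  · exact level_seven_poly_part3_63 p hp
  · exact level_seven_poly_part3_64 p hp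
  · exact level_seven_poly_part3_65 p hp
  · exact level_seven_poly_part3_66 p hp
  · exact level_seven_poly_part3_67 p hp
  · exact level_seven_poly_part3_68 p hp
  · exact level_seven_poly_part3_69 p hp
  · exact level_seven_poly_part3_70 p hp
  · exact level_seven_poly_part3_71 p hp
  · exact level_seven_poly_part3_72 p hp
  · exact level_seven_poly_part3_73 p hp
  · exact level_seven_poly_part3_74 p hp
  · exact level_seven_poly_part3_75 p hp
  · exact level_seven_poly_part3_76 p hp
  · exact level_seven_poly_part3_77 p hp
  · exact level_seven_poly_part3_78 p hp
  · exact level_seven_poly_part3_79 p hp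
  · exact level_seven_poly_part3_80 p hp
  · exact level_seven_poly_part3_81 p hp
  · exact level_seven_poly_part3_82 p hp
  · exact level_seven_poly_part3_83 p hp
  · exact level_seven_poly_part3_84 p hp
  · exact level_seven_poly_part3_85 p hp
  · exact level_seven_poly_part3_86 p hp
  · exact level_seven_poly_part3_87 p hp
  · exact level_seven_poly_part3_88 p hp
  · exact level_seven_poly_part3_89 p hp
  · exact level_seven_poly_part3_90 p hp
  · exact level_seven_poly_part3_91 p hp
  · exact level_seven_poly_part3_92 p hp
  · exact level_seven_poly_part3_93 p hp
  · exact level_seven_poly_part3_94 p hp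
  · exact level_seven_poly_part3_95 p hp

end ThmN

end PercRepro
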